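import Summits.MatrixMultiplication.MatrixMultiplication.Theorems.SoloInformedValFamilyFree

/-!
# SoloInformedValFamilyVal — `Val(n) ≥ n + 2` for every `n ≥ 261` (and `232 ≤ n ≤ 253`, `n ≠ 235, 236`)

Part 3 of `SoloInformedValFamily`: the bounds `X ⊆ [b+1, bmq-b]`, `Y ⊆ [·, b-1-2bm]`, `Z ⊆ [1, bmp-1]`, the normal
form `val_family` (translate into `{0,…,n}` for every `n ≥ max (bmp + bm - 3b - 2) (bmq - b - 3)`, target `n`, at least
`(b-1)((m-2)(p-1) + (m-1)(q-1))` solutions — Pratt [arXiv:2309.03878, Def. 4.2]: `Val(n)` ≥ that), and corollaries: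
`val_232'` (the member `(5,6,7,8)`: `Val(232) ≥ 236`, cf. `SoloInformedValSmall`), `val_ge_add_two_tail` (`n ≥ 613`
from the sub-family `(8,13,k,k+1)`), `val_ge_add_two` (EVERY `n ≥ 261`: thirteen members chain `[261, 612]`),
`val_ge_add_two_low`.  So `Val(n) > n + 1` for all `n ≥ 232` except possibly `235, 236, 254, …, 260`; exhaustive
search (not in Lean) gives `Val(n) = n + 1` for `n ≤ 12`.  No exponent: the members are lopsided (`a + b + c ≤ 2n`
fails), so they are not `Config`s of `SoloInformedValNormalForm` and enter no digit product.
-/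

namespace Summit.MatrixMultiplication.MatrixMultiplication.Theorems.SoloVal.Family

open Finset

variable {b m p q : ℤ}

/-! ## Bounds and the normal form -/

/-- `X ⊆ [b + 1, b m q - b]`. -/
theorem X_bound (hb : 2 ≤ b) (hm : 4 ≤ m) (hq : 2 ≤ q) : ∀ v ∈ X b m q, b + 1 ≤ v ∧ v ≤ b * m * q - b := by
  have hb0 : 0 < b := by omega
  have hbm : 0 < b * m := mul_pos hb0 (by omega)
  have hq2 : b * m * 2 ≤ b * m * q := mul_le_mul_of_nonneg_left hq hbm.le
  intro v hv
  simp only [X, mem_union, mem_X1, mem_X2] at hv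
  rcases hv with ⟨y, x, hy, hx, rfl⟩ | ⟨z, y, hz, hy, rfl⟩
  · have l1 : b * 1 ≤ b * y := mul_le_mul_of_nonneg_left hy.1 hb0.le
    have l2 : b * y ≤ b * (m - 2) := mul_le_mul_of_nonneg_left hy.2 hb0.le
    rw [mul_sub] at l2
    constructor <;> nlinarith
  · have l1 : b * 1 ≤ b * y := mul_le_mul_of_nonneg_left hy.1 hb0.le
    have l2 : b * y ≤ b * (m - 1) := mul_le_mul_of_nonneg_left hy.2 hb0.le
    have l3 : b * m * 2 ≤ b * m * z := mul_le_mul_of_nonneg_left hz.1 hbm.le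
    have l4 : b * m * z ≤ b * m * q := mul_le_mul_of_nonneg_left hz.2 hbm.le
    rw [mul_sub] at l2
    constructor <;> nlinarith

/-- `Y ⊆ [-(b m p) - b m + 2 b, ·] ∪ [1 - b m q, ·]`, everything `≤ b - 1 - 2 b m`. -/
theorem Y_bound (hb : 2 ≤ b) (hm : 4 ≤ m) : ∀ v ∈ Y b m p q,
    (-(b * m * p) - b * m + 2 * b ≤ v ∨ 1 - b * m * q ≤ v) ∧ v ≤ b - 1 - 2 * (b * m) := by
  have hb0 : 0 < b := by omega
  have hbm : 0 < b * m := mul_pos hb0 (by omega)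
  intro v hv
  simp only [Y, mem_union, mem_Y1, mem_Y2] at hv
  rcases hv with ⟨c, y, hc, hy, rfl⟩ | ⟨x, z, hx, hz, rfl⟩
  · have l1 : b * 1 ≤ b * y := mul_le_mul_of_nonneg_left hy.1 hb0.le
    have l2 : b * y ≤ b * (m - 2) := mul_le_mul_of_nonneg_left hy.2 hb0.le
    have l3 : b * m * 2 ≤ b * m * c := mul_le_mul_of_nonneg_left hc.1 hbm.le
    have l4 : b * m * c ≤ b * m * p := mul_le_mul_of_nonneg_left hc.2 hbm.le
    rw [mul_sub] at l2
    exact ⟨Or.inl (by nlinarith), by nlinarith⟩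
  · have l3 : b * m * 2 ≤ b * m * z := mul_le_mul_of_nonneg_left hz.1 hbm.le
    have l4 : b * m * z ≤ b * m * q := mul_le_mul_of_nonneg_left hz.2 hbm.le
    exact ⟨Or.inr (by nlinarith), by nlinarith⟩

/-- `Z ⊆ [1, b m p - 1]`. -/
theorem Z_bound (hb : 2 ≤ b) (hm : 4 ≤ m) (hp : 2 ≤ p) : ∀ v ∈ Z b m p, 1 ≤ v ∧ v ≤ b * m * p - 1 := by
  have hb0 : 0 < b := by omega
  have hbm : 0 < b * m := mul_pos hb0 (by omega)
  have hp2 : b * m * 2 ≤ b * m * p := mul_le_mul_of_nonneg_left hp hbm.le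
  have hm4 : b * 4 ≤ b * m := mul_le_mul_of_nonneg_left hm hb0.le
  intro v hv
  simp only [Z, mem_union, mem_Z1, mem_Z2] at hv
  rcases hv with ⟨c, x, hc, hx, rfl⟩ | ⟨y, x, hy, hx, rfl⟩
  · have l3 : b * m * 2 ≤ b * m * c := mul_le_mul_of_nonneg_left hc.1 hbm.le
    have l4 : b * m * c ≤ b * m * p := mul_le_mul_of_nonneg_left hc.2 hbm.le
    constructor <;> nlinarith
  · have l1 : b * 1 ≤ b * y := mul_le_mul_of_nonneg_left hy.1 hb0.le
    have l2 : b * y ≤ b * (m - 1) := mul_le_mul_of_nonneg_left hy.2 hb0.le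
    rw [mul_sub] at l2
    constructor <;> nlinarith

variable (b m p q)

/-- Normal form, `A`-part: `X - (b + 1)`. -/
noncomputable def A₀ : Finset ℤ := (X b m q).image (· + (-(b + 1)))
/-- Normal form, `B`-part for the target `n`: `Y + (n + b + 2)`. -/
noncomputable def B₀ (n : ℤ) : Finset ℤ := (Y b m p q).image (· + (n + b + 2))
/-- Normal form, `C`-part: `Z - 1`. -/
noncomputable def C₀ : Finset ℤ := (Z b m p).image (· + (-1))

variable {b m p q}

/-- THE FAMILY (Theorem I of the dossier): for `b ≥ 2`, `m ≥ 4`, `p, q ≥ 2` and every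
`n ≥ max (b m p + b m - 3 b - 2) (b m q - b - 3)`, the translated triple lies in `{0,…,n}³`, is equilateral
trapezoid-free for the target `n`, and `a + b + c = n` has at least `(b-1)((m-2)(p-1) + (m-1)(q-1))` solutions:
`Val(n) ≥ (b-1)((m-2)(p-1) + (m-1)(q-1))`. -/
theorem val_family (hb : 2 ≤ b) (hm : 4 ≤ m) (hp : 2 ≤ p) (hq : 2 ≤ q) {n : ℤ}
    (hn1 : b * m * p + b * m - 3 * b - 2 ≤ n) (hn2 : b * m * q - b - 3 ≤ n) :
    (∀ a ∈ A₀ b m q, 0 ≤ a ∧ a ≤ n) ∧ (∀ x ∈ B₀ b m p q n, 0 ≤ x ∧ x ≤ n) ∧ (∀ x ∈ C₀ b m p, 0 ≤ x ∧ x ≤ n) ∧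
      TrapezoidFree (A₀ b m q) (B₀ b m p q n) (C₀ b m p) n ∧
      (b - 1) * ((m - 2) * (p - 1)) + (b - 1) * ((m - 1) * (q - 1)) ≤
        ((solutions (A₀ b m q) (B₀ b m p q n) (C₀ b m p) n).card : ℤ) := by
  have hb0 : 0 < b := by omega
  have hm4 : b * 4 ≤ b * m := mul_le_mul_of_nonneg_left hm hb0.le
  have e : (0 : ℤ) + -(b + 1) + (n + b + 2) + -1 = n := by ring
  refine ⟨?_, ?_, ?_, ?_, ?_⟩
  · intro a ha
    obtain ⟨v, hv, rfl⟩ := mem_image.1 ha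
    have := X_bound hb hm hq v hv
    constructor <;> omega
  · intro x hx
    obtain ⟨v, hv, rfl⟩ := mem_image.1 hx
    obtain ⟨h1 | h1, h2⟩ := Y_bound hb hm v hv <;> constructor <;> omega
  · intro x hx
    obtain ⟨v, hv, rfl⟩ := mem_image.1 hx
    have := Z_bound hb hm hp v hv
    constructor <;> omega
  · have key := trapezoidFree_shift (-(b + 1)) (n + b + 2) (-1) (trapezoidFree_XYZ (p := p) (q := q) hb hm)
    rw [e] at key
    exact key
  · have key := card_solutions_shift (A := X b m q) (B := Y b m p q) (C := Z b m p) (t := 0) (-(b + 1)) (n + b + 2) (-1)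
    rw [e] at key
    have := card_solutions_ge hb hm hp hq
    calc (b - 1) * ((m - 2) * (p - 1)) + (b - 1) * ((m - 1) * (q - 1))
        ≤ ((solutions (X b m q) (Y b m p q) (Z b m p) 0).card : ℤ) := this
      _ ≤ _ := by exact_mod_cast key

/-- The member `(b, m, p, q) = (5, 6, 7, 8)` re-derives `Val(232) ≥ 236` (cf. `SoloInformedValSmall.val_232`). -/
theorem val_232' : ∃ A B C : Finset ℤ,
    (∀ a ∈ A, 0 ≤ a ∧ a ≤ 232) ∧ (∀ x ∈ B, 0 ≤ x ∧ x ≤ 232) ∧ (∀ x ∈ C, 0 ≤ x ∧ x ≤ 232) ∧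
      TrapezoidFree A B C 232 ∧ 236 ≤ ((solutions A B C 232).card : ℤ) := by
  obtain ⟨h1, h2, h3, h4, h5⟩ :=
    val_family (b := 5) (m := 6) (p := 7) (q := 8) (n := 232) (by norm_num) (by norm_num) (by norm_num) (by norm_num)
      (by norm_num) (by norm_num)
  exact ⟨_, _, _, h1, h2, h3, h4, by omega⟩

/-- THE TAIL: `Val(n) ≥ n + 2` for every `n ≥ 613`, from the sub-family `(8, 13, k, k+1)`
(`n₀ = 104 k + 93 ≤ n ≤ 104 k + 196 ≤ 161 k - 79 = T - 2` for `k ≥ 5`). -/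
theorem val_ge_add_two_tail {n : ℤ} (hn : 613 ≤ n) : ∃ A B C : Finset ℤ,
    (∀ a ∈ A, 0 ≤ a ∧ a ≤ n) ∧ (∀ x ∈ B, 0 ≤ x ∧ x ≤ n) ∧ (∀ x ∈ C, 0 ≤ x ∧ x ≤ n) ∧
      TrapezoidFree A B C n ∧ n + 2 ≤ ((solutions A B C n).card : ℤ) := by
  obtain ⟨k, hk1, hk2⟩ : ∃ k : ℤ, 104 * k + 93 ≤ n ∧ n ≤ 104 * k + 196 := ⟨(n - 93) / 104, by omega, by omega⟩
  have hk : 5 ≤ k := by omega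
  obtain ⟨h1, h2, h3, h4, h5⟩ :=
    val_family (b := 8) (m := 13) (p := k) (q := k + 1) (n := n) (by norm_num) (by norm_num) (by omega) (by omega)
      (by omega) (by omega)
  exact ⟨_, _, _, h1, h2, h3, h4, by omega⟩

/-- One member as a `Val(n) ≥ n + 2` witness. -/
theorem val_of_member {b m p q n : ℤ} (hb : 2 ≤ b) (hm : 4 ≤ m) (hp : 2 ≤ p) (hq : 2 ≤ q)
    (hn1 : b * m * p + b * m - 3 * b - 2 ≤ n) (hn2 : b * m * q - b - 3 ≤ n)
    (hT : n + 2 ≤ (b - 1) * ((m - 2) * (p - 1)) + (b - 1) * ((m - 1) * (q - 1))) :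
    ∃ A B C : Finset ℤ, (∀ a ∈ A, 0 ≤ a ∧ a ≤ n) ∧ (∀ x ∈ B, 0 ≤ x ∧ x ≤ n) ∧ (∀ x ∈ C, 0 ≤ x ∧ x ≤ n) ∧
      TrapezoidFree A B C n ∧ n + 2 ≤ ((solutions A B C n).card : ℤ) := by
  obtain ⟨h1, h2, h3, h4, h5⟩ := val_family hb hm hp hq hn1 hn2
  exact ⟨_, _, _, h1, h2, h3, h4, hT.trans h5⟩

/-- `Val(n) ≥ n + 2` for EVERY `n ≥ 261`: thirteen members chain `[261, 612]`, then the tail. -/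
theorem val_ge_add_two {n : ℤ} (hn : 261 ≤ n) : ∃ A B C : Finset ℤ,
    (∀ a ∈ A, 0 ≤ a ∧ a ≤ n) ∧ (∀ x ∈ B, 0 ≤ x ∧ x ≤ n) ∧ (∀ x ∈ C, 0 ≤ x ∧ x ≤ n) ∧
      TrapezoidFree A B C n ∧ n + 2 ≤ ((solutions A B C n).card : ℤ) := by
  by_cases g0 : 613 ≤ n
  · exact val_ge_add_two_tail g0
  by_cases g1 : n ≤ 263
  · exact val_of_member (b := 6) (m := 5) (p := 8) (q := 9) (by norm_num) (by norm_num) (by norm_num) (by norm_num)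
      (by omega) (by omega) (by omega)
  by_cases g2 : n ≤ 270
  · exact val_of_member (b := 5) (m := 6) (p := 8) (q := 9) (by norm_num) (by norm_num) (by norm_num) (by norm_num)
      (by omega) (by omega) (by omega)
  by_cases g3 : n ≤ 274
  · exact val_of_member (b := 7) (m := 5) (p := 7) (q := 8) (by norm_num) (by norm_num) (by norm_num) (by norm_num)
      (by omega) (by omega) (by omega)
  by_cases g4 : n ≤ 286
  · exact val_of_member (b := 5) (m := 7) (p := 7) (q := 8) (by norm_num) (by norm_num) (by norm_num) (by norm_num)
      (by omega) (by omega) (by omega)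
  by_cases g5 : n ≤ 303
  · exact val_of_member (b := 6) (m := 7) (p := 6) (q := 7) (by norm_num) (by norm_num) (by norm_num) (by norm_num)
      (by omega) (by omega) (by omega)
  by_cases g6 : n ≤ 313
  · exact val_of_member (b := 4) (m := 7) (p := 10) (q := 11) (by norm_num) (by norm_num) (by norm_num) (by norm_num)
      (by omega) (by omega) (by omega)
  by_cases g7 : n ≤ 338
  · exact val_of_member (b := 5) (m := 8) (p := 7) (q := 8) (by norm_num) (by norm_num) (by norm_num) (by norm_num)
      (by omega) (by omega) (by omega)
  by_cases g8 : n ≤ 364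
  · exact val_of_member (b := 7) (m := 7) (p := 6) (q := 7) (by norm_num) (by norm_num) (by norm_num) (by norm_num)
      (by omega) (by omega) (by omega)
  by_cases g9 : n ≤ 390
  · exact val_of_member (b := 5) (m := 8) (p := 8) (q := 9) (by norm_num) (by norm_num) (by norm_num) (by norm_num)
      (by omega) (by omega) (by omega)
  by_cases g10 : n ≤ 430
  · exact val_of_member (b := 7) (m := 7) (p := 7) (q := 8) (by norm_num) (by norm_num) (by norm_num) (by norm_num)
      (by omega) (by omega) (by omega)
  by_cases g11 : n ≤ 496
  · exact val_of_member (b := 7) (m := 7) (p := 8) (q := 9) (by norm_num) (by norm_num) (by norm_num) (by norm_num)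
      (by omega) (by omega) (by omega)
  by_cases g12 : n ≤ 586
  · exact val_of_member (b := 7) (m := 8) (p := 8) (q := 9) (by norm_num) (by norm_num) (by norm_num) (by norm_num)
      (by omega) (by omega) (by omega)
  · exact val_of_member (b := 6) (m := 9) (p := 10) (q := 11) (by norm_num) (by norm_num) (by norm_num) (by norm_num)
      (by omega) (by omega) (by omega)

/-- The low range: `Val(n) ≥ n + 2` for `232 ≤ n ≤ 253`, `n ≠ 235, 236` (four members).  Together with
`val_ge_add_two`: every `n ≥ 232` except possibly the nine values `235, 236, 254, …, 260`. -/
theorem val_ge_add_two_low {n : ℤ} (h1 : 232 ≤ n) (h2 : n ≤ 253) (h3 : n ≠ 235) (h4 : n ≠ 236) :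
    ∃ A B C : Finset ℤ, (∀ a ∈ A, 0 ≤ a ∧ a ≤ n) ∧ (∀ x ∈ B, 0 ≤ x ∧ x ≤ n) ∧ (∀ x ∈ C, 0 ≤ x ∧ x ≤ n) ∧
      TrapezoidFree A B C n ∧ n + 2 ≤ ((solutions A B C n).card : ℤ) := by
  by_cases g1 : n ≤ 234
  · exact val_of_member (b := 5) (m := 6) (p := 7) (q := 8) (by norm_num) (by norm_num) (by norm_num) (by norm_num)
      (by omega) (by omega) (by omega)
  by_cases g2 : n ≤ 242
  · exact val_of_member (b := 5) (m := 7) (p := 6) (q := 7) (by norm_num) (by norm_num) (by norm_num) (by norm_num)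
      (by omega) (by omega) (by omega)
  by_cases g3 : n ≤ 248
  · exact val_of_member (b := 6) (m := 6) (p := 6) (q := 7) (by norm_num) (by norm_num) (by norm_num) (by norm_num)
      (by omega) (by omega) (by omega)
  · exact val_of_member (b := 4) (m := 8) (p := 7) (q := 8) (by norm_num) (by norm_num) (by norm_num) (by norm_num)
      (by omega) (by omega) (by omega)

end Summit.MatrixMultiplication.MatrixMultiplication.Theorems.SoloVal.Family
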